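import Summits.SmoothPoincare4.SmoothPoincare4.Theses.DottedCircleRasmussen
import Literature.Topology.FourManifolds.MMSWRasmussenFacts
import Literature.Topology.FourManifolds.SliceDiscInTransport
import Summits.SmoothPoincare4.SmoothPoincare4.Theorems.DottedCircleRasmussenDcrGfgmw

/-!
# Stub `stub_offPoint` (K2) of line `Sketch` for crux `DottedCircleRasmussen.DcrRigidity`
(item stmt-SmoothPoincare4-17014, route route-SmoothPoincare4-DottedCircleRasmussen)

**Re-choosing a `D_k`-datum off a point.** Let `K ⊂ D_k = modelHandlebody k` be a circle, `M` a
smooth 4-manifold and `(e, f)` a slice datum for `K` in the complement of `e(D_k)`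
(`MMSW.IsSliceDiscInComplement k K M e f`: `e : ℝ⁴ ↪ M` a smooth embedding, `f : ℝ² → M` a smooth
disc, embedded on `𝔻²`, proper with respect to `e(D_k)`, bounded by `e ∘ K`). Then the chart `e`
can be replaced by a chart `e'` with the SAME disc `f`, still a datum, such that some point
`q ∈ M` lies neither on `e'(ℝ⁴)` nor on `f(ℝ²)` — the input of the transplant of the datum into
`S⁴` along an embedding of the puncture `M ∖ {q}`.

Proof (the `D_k` copy of the tree's `Knot.IsSliceDiscIn.exists_notMem_range`, without the
homogeneity step since `q` is free). With `c = 5(k+1) + 1` one has `D_k ⊆ B̄(0, 40(k+1)+1) ⊆ B(0, 8c)`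
(`DcrGfgmw.norm_le_of_mem_modelHandlebody`). Shrink the chart at scale `c`: conjugating the tree's
`exists_isSmoothEmbedding_eqOn_ball` by the homothety `c • id` gives a smooth embedding `e'` with
`e' = e` on `B(0, 8c) ⊇ D_k` and `e'(ℝ⁴) ⊆ e(B(0, 32c))`; so `e'(D_k) = e(D_k)`, `e' ∘ K = e ∘ K`, and
`(e', f)` is a datum. The dimension count `exists_lt_norm_apply_notMem_range` (`2 < 4`) gives `v`
with `‖v‖ > 32c` and `e v ∉ f(ℝ²)`; by injectivity of `e`, `q = e v ∉ e(B(0, 32c)) ⊇ e'(ℝ⁴)`.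

References: J. Milnor, *Topology from the Differentiable Viewpoint* (1965), §3 (easy Sard)
[MilnorTDV1965]; C. Manolescu, L. Piccirillo, J. Lond. Math. Soc. 108 (2023), Def. 2.1
[ManolescuPiccirillo2023]. No `sorry`, no named facts.
-/

noncomputable section

set_option linter.dupNamespace false

open scoped Manifold ContDiff Topology ContinuousMap
open Set Function Metric
open Literature.Topology.FourManifolds Literature.Topology.FourManifolds.MMSW
open Summit.SmoothPoincare4.SmoothPoincare4.Theses.DottedCircleRasmussen

namespace Summit.SmoothPoincare4.SmoothPoincare4.Cruxes.DcrRigidity.Sketch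

local notation "𝔼⁴" => EuclideanSpace ℝ (Fin 4)
local notation "𝔼²" => EuclideanSpace ℝ (Fin 2)
local notation "𝕊¹" => (Metric.sphere (0 : EuclideanSpace ℝ (Fin 2)) 1)
local notation "𝕊⁴" => (Metric.sphere (0 : EuclideanSpace ℝ (Fin 5)) 1)

/-! ## Shrinking a chart at scale `c` -/

/-- **Shrinking a ball at scale `c > 0`.** For every smooth embedding `e : ℝ⁴ ↪ M` into a
4-manifold there is a smooth embedding `e' : ℝ⁴ ↪ M` which agrees with `e` on `B(0, 8c)` and whose
range lies in `e(B(0, 32c))`: conjugate the tree's `exists_isSmoothEmbedding_eqOn_ball` (the case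
`c = 1`) by the homothety `L = c • id`, i.e. shrink `e ∘ L` and precompose with `L⁻¹`. [folklore] -/
theorem offPoint_exists_isSmoothEmbedding_eqOn_ball_scale
    {M : Type*} [TopologicalSpace M] [ChartedSpace 𝔼⁴ M] [IsManifold (𝓡 4) ∞ M]
    {e : 𝔼⁴ → M} (he : Manifold.IsSmoothEmbedding (𝓡 4) (𝓡 4) ∞ e) {c : ℝ} (hc : 0 < c) :
    ∃ e' : 𝔼⁴ → M, Manifold.IsSmoothEmbedding (𝓡 4) (𝓡 4) ∞ e' ∧
      (∀ w, ‖w‖ < 8 * c → e' w = e w) ∧ range e' ⊆ e '' ball 0 (32 * c) := by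
  obtain ⟨L, hL, hLs⟩ : ∃ L : 𝔼⁴ ≃L[ℝ] 𝔼⁴, (∀ w, L w = c • w) ∧ ∀ w, L.symm w = c⁻¹ • w :=
    ⟨ContinuousLinearEquiv.equivOfInverse ((c : ℝ) • ContinuousLinearMap.id ℝ 𝔼⁴)
        ((c⁻¹ : ℝ) • ContinuousLinearMap.id ℝ 𝔼⁴)
        (fun w => by simp [smul_smul, hc.ne']) (fun w => by simp [smul_smul, hc.ne']),
      fun _ => rfl, fun _ => rfl⟩
  have h1 : Manifold.IsSmoothEmbedding (𝓡 4) (𝓡 4) ∞ (e ∘ (L : 𝔼⁴ → 𝔼⁴)) :=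
    he.comp_diffeomorph L.toDiffeomorph
  obtain ⟨e₂, he₂, hee₂, hr₂⟩ := exists_isSmoothEmbedding_eqOn_ball h1
  refine ⟨e₂ ∘ (L.symm : 𝔼⁴ → 𝔼⁴), he₂.comp_diffeomorph L.symm.toDiffeomorph, fun w hw => ?_, ?_⟩
  · have hw' : ‖L.symm w‖ < 8 := by
      rw [hLs, norm_smul, Real.norm_of_nonneg (inv_nonneg.2 hc.le)]
      calc c⁻¹ * ‖w‖ < c⁻¹ * (8 * c) := mul_lt_mul_of_pos_left hw (inv_pos.2 hc)
        _ = 8 := by field_simp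
    change e₂ (L.symm w) = e w
    rw [hee₂ _ hw']
    change e (L (L.symm w)) = e w
    rw [L.apply_symm_apply]
  · rintro _ ⟨w, rfl⟩
    obtain ⟨u, hu, hu'⟩ := hr₂ ⟨L.symm w, rfl⟩
    refine ⟨L u, ?_, hu'⟩
    rw [mem_ball_zero_iff] at hu ⊢
    rw [hL, norm_smul, Real.norm_of_nonneg hc.le]
    calc c * ‖u‖ < c * 32 := mul_lt_mul_of_pos_left hu hc
      _ = 32 * c := mul_comm _ _

/-! ## Stub K2 — re-choose the datum off a point -/

/-- **K2 (`OffPoint`).** A slice datum `(e, f)` for `K ⊂ D_k` in the complement of `e(D_k)` inside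
any smooth 4-manifold `M` can be re-chosen with the same disc `f` and a new chart `e'` (agreeing
with `e` on a ball containing `D_k`, with bounded range `e'(ℝ⁴) ⊆ e(B(0, 32c))`, `c = 5(k+1)+1`) so
that some point `q ∈ M` lies neither on `e'(ℝ⁴)` nor on `f(ℝ²)`.  Shrink
(`offPoint_exists_isSmoothEmbedding_eqOn_ball_scale`, `8c > 40(k+1)+1 ≥ sup_{D_k} ‖·‖` by
`DcrGfgmw.norm_le_of_mem_modelHandlebody`), then the dimension count
`exists_lt_norm_apply_notMem_range` (`m = 2 < 4 = n`, radius `32c`) gives `v` with `e v ∉ f(ℝ²)`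
and `‖v‖ > 32c`, so `q = e v ∉ e'(ℝ⁴) ⊆ e(B(0, 32c))` by injectivity of `e`. [folklore] -/
theorem stub_offPoint {k : ℕ} {K : 𝕊¹ → 𝔼⁴} (hK : ∀ t, K t ∈ modelHandlebody k)
    {M : Type} [TopologicalSpace M] [ChartedSpace 𝔼⁴ M] [IsManifold (𝓡 4) ∞ M]
    {e : 𝔼⁴ → M} {f : 𝔼² → M} (h : IsSliceDiscInComplement k K M e f) :
    ∃ (e' : 𝔼⁴ → M) (q : M), IsSliceDiscInComplement k K M e' f ∧ q ∉ range e' ∧ q ∉ range f := by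
  obtain ⟨he, hf, hinj, hmf, hproper, hbdry⟩ := h
  -- the scale `c = 5(k+1) + 1`: `D_k ⊆ B̄(0, 40(k+1)+1) ⊆ B(0, 8c)`
  obtain ⟨c, hcdef⟩ : ∃ c : ℝ, c = 5 * ((k : ℝ) + 1) + 1 := ⟨_, rfl⟩
  have hc : 0 < c := by rw [hcdef]; positivity
  have hDc : ∀ x : 𝔼⁴, x ∈ modelHandlebody k → ‖x‖ < 8 * c := fun x hx => by
    have hxR := Theorems.DcrGfgmw.norm_le_of_mem_modelHandlebody hx
    rw [hcdef]
    linarith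
  -- shrink the chart, then pick a far-out point of the old chart off the disc
  obtain ⟨e', he', hee', hr⟩ := offPoint_exists_isSmoothEmbedding_eqOn_ball_scale he hc
  obtain ⟨v, hv, hvf⟩ := exists_lt_norm_apply_notMem_range (m := 2) (n := 4) (X := M)
    (by norm_num) he hf (32 * c)
  have himg : e' '' modelHandlebody k = e '' modelHandlebody k := by
    refine Subset.antisymm ?_ ?_
    · rintro _ ⟨w, hw, rfl⟩
      exact ⟨w, hw, (hee' w (hDc w hw)).symm⟩
    · rintro _ ⟨w, hw, rfl⟩
      exact ⟨w, hw, hee' w (hDc w hw)⟩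
  refine ⟨e', e v, ⟨he', hf, hinj, hmf, fun x hx => ?_, fun t => ?_⟩, ?_, hvf⟩
  · rw [himg]
    exact hproper x hx
  · rw [hbdry t, hee' _ (hDc _ (hK t))]
  · rintro ⟨w, hw⟩
    obtain ⟨u, hu, hu'⟩ := hr ⟨w, rfl⟩
    have h1 : u = v := he.isEmbedding.injective (hu'.trans hw)
    rw [mem_ball_zero_iff, h1] at hu
    exact lt_asymm hu hv

end Summit.SmoothPoincare4.SmoothPoincare4.Cruxes.DcrRigidity.Sketch

end
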